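import Summits.Ventures.WeilGRH.UniformConductorFloorCoprimeSound
import Summits.Ventures.WeilGRH.UniformConductorFloorJointR640Log9UniFrame
import Summits.Ventures.WeilGRH.UniformConductorFloorJointR640Log9UniCellsA
import Summits.Ventures.WeilGRH.UniformConductorFloorJointR640Log9UniCellsB
import Summits.Ventures.WeilGRH.UniformConductorFloorJointR640Log9UniCellsC
import Summits.Ventures.WeilGRH.UniformConductorFloorJointR640Log9UniCellsD
import Summits.Ventures.WeilGRH.UniformConductorFloorJointR640Log9UniCellsE
import Summits.Ventures.WeilGRH.UniformConductorFloorJointR640Log9Dvd3Frame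
import Summits.Ventures.WeilGRH.UniformConductorFloorJointR640Log9Dvd3CellsA
import Summits.Ventures.WeilGRH.UniformConductorFloorJointR640Log9Dvd3CellsB
import Summits.Ventures.WeilGRH.UniformConductorFloorJointR640Log9Dvd3CellsC
import Summits.Ventures.WeilGRH.UniformConductorFloorJointR640Log9Dvd3CellsD
import Summits.Ventures.WeilGRH.UniformConductorFloorJointR640Log9Dvd3CellsE
import Summits.Ventures.WeilGRH.UniformConductorFloorLog9Decision
import HarnessLib

/-!
# GRH arm (rh-explicit, venture WeilGRH): ★ the R = 640 floors at `log 3` — every character of every modulus `q ≥ 131`, and of every `q ≥ 69` with `3 ∣ q` —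
  and the all-moduli decision at `log 3` modulo the single prime `127`

Cell `rh-explicit`, WEIL TRACK — GRH ARM (weil-grh-1, gen9).  The two EVEN joint cell certificates of `UniformConductorFloorJointData640Log9.lean` on the finer grid
`R = 640`, `J = 704` (window `704 log(640/639) = 1.100860 ≥ log 3`; frame + five cell ranges each kernel-checked in its own file) through gen6's
`JointCert.weilPositivityOnChar_of_parts` (uniform: budget 4.8661 → e^· = 129.81 → `Q₀ = 131`, `log 131 ≥ 4 log 2 + 2 log 3 − 13/131`) and gen7's
`JointCert.weilPositivityOnChar_of_le_of_parts_coprime` (level 3: budget 4.2291 → e^· = 68.65 → `Q₀ = 69`, `log 69 ≥ 3 log 2 + 2 log 3 − 3/69`); odd characters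
by the typed odd floors `49` / `3 ∣ q ≥ 27`.  These close `131` and `69`, two of the three moduli left open by `UniformConductorFloorLog9Decision.lean`.
**THEOREM (`forall_weilPositivityOnChar_log_three_iff_not_mem_of_ne`).**  For every `q ≥ 2`, `q ≠ 127`: every Dirichlet character mod `q` is Weil-positive on
`[-log 3, log 3]` iff `q ∉ F₉⁺` (66 moduli); for PRIME `p ≠ 127`: iff `p ≥ 131`.  The prime `127` (flat threshold 123.19; Galerkin bottoms 124.94/124.97/124.99/125.01
at 32/48/64/96 modes, 1/K-extrapolated true threshold ≈ 125.05; floor now 131) is expected TRUE with margin ≈ 0.0155 and needs a direct principal cell at this window.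
RH/GRH-free; standard axioms.

## References

* A. Weil (1952), (11) pp. 261–262 and the «lemme» p. 262 [Weil1952FormulesExplicites]; L. Collatz (1942) / H. Wielandt (1950). [folklore]
-/

noncomputable section

open Real Set
open scoped ArithmeticFunction.vonMangoldt

namespace Summit.Ventures.WeilGRH

open Literature.NumberTheory.LFunctions

namespace UniformFloor

variable {q : ℕ}

/-! ## Inputs: window, weights, budgets -/

/-- `log 3 ≤ 704 log(640/639)` (`9·639^1408 ≤ 640^1408`). [folklore] -/
theorem log_three_le_t_640 (c : JointCert) (hR : c.R = 640) (hJ : c.J = 704) : Real.log 3 ≤ c.t := by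
  rw [JointCert.t_eq_log, hR, hJ]
  have h : Real.log 9 ≤ Real.log (((((640 : ℕ) : ℝ) / (((640 : ℕ) : ℝ) - 1)) ^ 704) ^ 2) := by
    refine Real.log_le_log (by norm_num) ?_
    rw [← pow_mul, div_pow, le_div_iff₀ (by norm_num)]
    have h0 : (9 : ℝ) * 639 ^ 1408 ≤ 640 ^ 1408 := by exact_mod_cast (by decide +kernel : 9 * 639 ^ 1408 ≤ 640 ^ 1408)
    norm_num
    exact h0
  rw [Real.log_pow, show (9 : ℝ) = 3 ^ 2 by norm_num, Real.log_pow] at h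
  push_cast at h ⊢
  linarith

/-- The weights of `certEvenDvd3R640Log9` dominate `Λ(n)/√n` on the `n ≤ 9` prime to `3`; the other weights are `0`. [folklore] -/
theorem certEvenDvd3R640Log9_hw : ∀ n ∈ Finset.range (certEvenDvd3R640Log9.N + 1),
    (if n.Coprime 3 then (Λ n : ℝ) / Real.sqrt n else 0) ≤ certEvenDvd3R640Log9.wbar n := by
  intro n hn
  have hnN : n < 10 := by simpa [show certEvenDvd3R640Log9.N = 9 from rfl] using Finset.mem_range.1 hn
  have h7 : ∀ k < 8, (Λ k : ℝ) / Real.sqrt k ≤ wbar7 k := fun k hk ↦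
    wbar7_ge 7 le_rfl k (Finset.mem_range.2 (by omega))
  unfold JointCert.wbar
  rw [show certEvenDvd3R640Log9.D = 1048576 from rfl]
  interval_cases n
  · rw [if_neg (by decide), show certEvenDvd3R640Log9.weights.getD 0 0 = 0 from rfl]
    norm_num
  · rw [if_pos (by decide), show certEvenDvd3R640Log9.weights.getD 1 0 = 0 from rfl]
    exact (h7 1 (by norm_num)).trans (by norm_num [wbar7])
  · rw [if_pos (by decide), show certEvenDvd3R640Log9.weights.getD 2 0 = 513950 from rfl]
    exact (h7 2 (by norm_num)).trans (by norm_num [wbar7])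
  · rw [if_neg (by decide), show certEvenDvd3R640Log9.weights.getD 3 0 = 0 from rfl]
    norm_num
  · rw [if_pos (by decide), show certEvenDvd3R640Log9.weights.getD 4 0 = 363409 from rfl]
    exact (h7 4 (by norm_num)).trans (by norm_num [wbar7])
  · rw [if_pos (by decide), show certEvenDvd3R640Log9.weights.getD 5 0 = 754726 from rfl]
    exact (h7 5 (by norm_num)).trans (by norm_num [wbar7])
  · rw [if_neg (by decide), show certEvenDvd3R640Log9.weights.getD 6 0 = 0 from rfl]
    norm_num
  · rw [if_pos (by decide), show certEvenDvd3R640Log9.weights.getD 7 0 = 771213 from rfl]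
    exact (h7 7 (by norm_num)).trans (by norm_num [wbar7])
  · rw [if_pos (by decide), show certEvenDvd3R640Log9.weights.getD 8 0 = 256975 from rfl]
    simpa using vonMangoldt_eight_div_sqrt_le
  · rw [if_neg (by decide), show certEvenDvd3R640Log9.weights.getD 9 0 = 0 from rfl]
    norm_num

/-- The budget of `certEven640Log9`: `log π − (−4.22745354) − Clow/D + RHO/D = 4.866062 ≤ log 131`
(`log 131 ≥ 4 log 2 + 2 log 3 − 13/131 = 4.870577`). [folklore] -/
theorem certEven640Log9_budget :
    Real.log Real.pi - (-4.22745354) - (certEven640Log9.Clow : ℝ) / certEven640Log9.D + (certEven640Log9.RHO : ℝ) / certEven640Log9.D ≤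
      Real.log (131 : ℕ) := by
  have hπ := Literature.Analysis.SpecialFunctions.Real.log_pi_le
  have h2 := Real.log_two_gt_d9
  have h3 := Real.log_three_gt_d9
  have hl : Real.log ((144 : ℝ) / 131) ≤ 144 / 131 - 1 := Real.log_le_sub_one_of_pos (by norm_num)
  have hS : Real.log (144 : ℝ) = 4 * Real.log 2 + 2 * Real.log 3 := by
    rw [show (144 : ℝ) = 2 ^ 4 * 3 ^ 2 by norm_num, Real.log_mul (by norm_num) (by norm_num), Real.log_pow, Real.log_pow]
    push_cast
    ring
  rw [Real.log_div (by norm_num) (by norm_num), hS] at hl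
  rw [show certEven640Log9.Clow = 7858731 from rfl, show certEven640Log9.D = 1048576 from rfl,
    show certEven640Log9.RHO = 7328024 from rfl]
  push_cast at *
  linarith

/-- The budget of `certEvenDvd3R640Log9`: `… = 4.229061 ≤ log 69` (`log 69 ≥ 3 log 2 + 2 log 3 − 3/69 = 4.233188`). [folklore] -/
theorem certEvenDvd3R640Log9_budget :
    Real.log Real.pi - (-4.22745354) - (certEvenDvd3R640Log9.Clow : ℝ) / certEvenDvd3R640Log9.D +
        (certEvenDvd3R640Log9.RHO : ℝ) / certEvenDvd3R640Log9.D ≤ Real.log (69 : ℕ) := by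
  have hπ := Literature.Analysis.SpecialFunctions.Real.log_pi_le
  have h2 := Real.log_two_gt_d9
  have h3 := Real.log_three_gt_d9
  have hl : Real.log ((72 : ℝ) / 69) ≤ 72 / 69 - 1 := Real.log_le_sub_one_of_pos (by norm_num)
  have hS : Real.log (72 : ℝ) = 3 * Real.log 2 + 2 * Real.log 3 := by
    rw [show (72 : ℝ) = 2 ^ 3 * 3 ^ 2 by norm_num, Real.log_mul (by norm_num) (by norm_num), Real.log_pow, Real.log_pow]
    push_cast
    ring
  rw [Real.log_div (by norm_num) (by norm_num), hS] at hl
  rw [show certEvenDvd3R640Log9.Clow = 7858731 from rfl, show certEvenDvd3R640Log9.D = 1048576 from rfl,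
    show certEvenDvd3R640Log9.RHO = 6660080 from rfl]
  push_cast at *
  linarith

/-! ## The cells, reassembled -/

/-- All `704` cells of `certEven640Log9`, reassembled from the five kernel ranges. [folklore] -/
theorem certEven640Log9_cells : ∀ j < certEven640Log9.J, certEven640Log9.cellOKB j = true := by
  intro j hj
  have hJ : certEven640Log9.J = 704 := rfl
  by_cases h1 : j < 176
  · exact certEven640Log9.cellsLoop_spec 176 0 (by omega) certEven640Log9_cellsA j (Nat.zero_le _) (by omega)
  by_cases h2 : j < 352
  · exact certEven640Log9.cellsLoop_spec 176 176 (by omega) certEven640Log9_cellsB j (by omega) (by omega)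
  by_cases h3 : j < 528
  · exact certEven640Log9.cellsLoop_spec 176 352 (by omega) certEven640Log9_cellsC j (by omega) (by omega)
  by_cases h4 : j < 616
  · exact certEven640Log9.cellsLoop_spec 88 528 (by omega) certEven640Log9_cellsD j (by omega) (by omega)
  · exact certEven640Log9.cellsLoop_spec 88 616 (by omega) certEven640Log9_cellsE j (by omega) (by omega)

/-- All `704` cells of `certEvenDvd3R640Log9`, reassembled from the five kernel ranges. [folklore] -/
theorem certEvenDvd3R640Log9_cells : ∀ j < certEvenDvd3R640Log9.J, certEvenDvd3R640Log9.cellOKB j = true := by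
  intro j hj
  have hJ : certEvenDvd3R640Log9.J = 704 := rfl
  by_cases h1 : j < 176
  · exact certEvenDvd3R640Log9.cellsLoop_spec 176 0 (by omega) certEvenDvd3R640Log9_cellsA j (Nat.zero_le _) (by omega)
  by_cases h2 : j < 352
  · exact certEvenDvd3R640Log9.cellsLoop_spec 176 176 (by omega) certEvenDvd3R640Log9_cellsB j (by omega) (by omega)
  by_cases h3 : j < 528
  · exact certEvenDvd3R640Log9.cellsLoop_spec 176 352 (by omega) certEvenDvd3R640Log9_cellsC j (by omega) (by omega)
  by_cases h4 : j < 616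
  · exact certEvenDvd3R640Log9.cellsLoop_spec 88 528 (by omega) certEvenDvd3R640Log9_cellsD j (by omega) (by omega)
  · exact certEvenDvd3R640Log9.cellsLoop_spec 88 616 (by omega) certEvenDvd3R640Log9_cellsE j (by omega) (by omega)

/-! ## The floors -/

/-- ★ Every EVEN character of every modulus `q ≥ 131` at the rung `log 3` (R = 640 uniform certificate; gen6's floor was 133). [folklore] -/
theorem weilPositivityOnChar_log_three_of_even_ge_131 (hq : 131 ≤ q) (χ : DirichletCharacter ℂ q) (hpar : charParity χ = 0) :
    WeilPositivityOnChar χ (Real.log 3) := by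
  have h := certEven640Log9.weilPositivityOnChar_of_parts certEven640Log9_checkFrame certEven640Log9_cells
    (hw_of_weights9 certEven640Log9 rfl rfl rfl) psi_even_ge (Q₀ := 131) (by norm_num) certEven640Log9_budget (by omega) hq χ hpar
  have ht := log_three_le_t_640 certEven640Log9 rfl rfl
  exact fun g hg hsupp ↦ h g hg (hsupp.trans (Icc_subset_Icc (by linarith) ht))

/-- ★★ EVERY Dirichlet character of EVERY modulus `q ≥ 131` satisfies `WeilPositivityOnChar χ (log 3)` (odd ones from `49`) — in particular `U_{log 3}(131)`.
[cite: Weil1952FormulesExplicites, (11) and the «lemme» p. 262] -/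
theorem weilPositivityOnChar_log_three_of_ge_131 (hq : 131 ≤ q) (χ : DirichletCharacter ℂ q) : WeilPositivityOnChar χ (Real.log 3) := by
  rcases Nat.le_one_iff_eq_zero_or_eq_one.1 (charParity_le_one χ) with h | h
  · exact weilPositivityOnChar_log_three_of_even_ge_131 hq χ h
  · exact weilPositivityOnChar_log_three_of_odd_ge_49 (by omega) χ h

/-- ★ Every EVEN character of every modulus `q ≥ 69` with `3 ∣ q` at the rung `log 3` (R = 640 level-3 certificate; the R = 320 floor was 72). [folklore] -/
theorem weilPositivityOnChar_log_three_of_even_three_dvd_ge_69 (hm : 3 ∣ q) (hq : 69 ≤ q) (χ : DirichletCharacter ℂ q)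
    (hpar : charParity χ = 0) : WeilPositivityOnChar χ (Real.log 3) :=
  certEvenDvd3R640Log9.weilPositivityOnChar_of_le_of_parts_coprime certEvenDvd3R640Log9_checkFrame
    certEvenDvd3R640Log9_cells certEvenDvd3R640Log9_hw psi_even_ge
    (Q₀ := 69) (by norm_num) certEvenDvd3R640Log9_budget (by omega) hm hq χ hpar (log_three_le_t_640 certEvenDvd3R640Log9 rfl rfl)

/-- ★★ EVERY Dirichlet character of EVERY modulus `q ≥ 69` with `3 ∣ q` satisfies `WeilPositivityOnChar χ (log 3)` (odd ones from `3 ∣ q ≥ 27`) — in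
particular `U_{log 3}(69)`. [cite: Weil1952FormulesExplicites, (11) and the «lemme» p. 262] -/
theorem weilPositivityOnChar_log_three_of_three_dvd_ge_69 (hm : 3 ∣ q) (hq : 69 ≤ q) (χ : DirichletCharacter ℂ q) :
    WeilPositivityOnChar χ (Real.log 3) := by
  rcases Nat.le_one_iff_eq_zero_or_eq_one.1 (charParity_le_one χ) with h | h
  · exact weilPositivityOnChar_log_three_of_even_three_dvd_ge_69 hm hq χ h
  · exact weilPositivityOnChar_log_three_of_odd_three_dvd_ge_27 hm (by omega) χ h

/-! ## All moduli at `log 3`, modulo `127` -/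

/-- ★★★ **ALL MODULI at `log 3`, modulo the prime `127`.**  For every `q ≥ 2`, `q ≠ 127`: every Dirichlet character mod `q` is Weil-positive on
`[-log 3, log 3]` iff `q ∉ F₉⁺ = F₉ ∪ {45, 85}` (66 moduli). [cite: Weil1952FormulesExplicites, (11) pp. 261–262 and the «lemme» p. 262] -/
theorem forall_weilPositivityOnChar_log_three_iff_not_mem_of_ne (hq2 : 2 ≤ q) (h127 : q ≠ 127) :
    (∀ χ : DirichletCharacter ℂ q, WeilPositivityOnChar χ (Real.log 3)) ↔
      q ∉ ({2, 3, 4, 5, 6, 7, 8, 9, 10, 11, 12, 13, 14, 15, 16, 17, 18, 19, 20, 21, 22, 23, 24, 25, 26, 27, 28, 29, 31, 32,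
      33, 34, 35, 37, 38, 39, 41, 43, 44, 45, 46, 47, 49, 51, 53, 55, 57, 59, 61, 65, 67, 71, 73, 77, 79, 83, 85, 89,
      91, 97, 101, 103, 107, 109, 113, 121} : Finset ℕ) := by
  by_cases h69 : q = 69
  · subst h69
    exact ⟨fun _ h ↦ by simp at h, fun _ χ ↦ weilPositivityOnChar_log_three_of_three_dvd_ge_69 (by norm_num) le_rfl χ⟩
  by_cases h131 : q = 131
  · subst h131
    exact ⟨fun _ h ↦ by simp at h, fun _ χ ↦ weilPositivityOnChar_log_three_of_ge_131 le_rfl χ⟩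
  have hE : q ∉ ({69, 127, 131} : Finset ℕ) := by
    simp only [Finset.mem_insert, Finset.mem_singleton]
    omega
  exact forall_weilPositivityOnChar_log_three_iff_not_mem hq2 hE

/-- ★★ **PRIME MODULI at `log 3`, modulo `127`.**  For a prime `p ≠ 127`: every Dirichlet character mod `p` is Weil-positive on `[-log 3, log 3]` iff `p ≥ 131`
(`113` is the largest failing prime; at `t = 1` the threshold was `79`, at `(log 8)/2` it was `97`). [cite: Weil1952FormulesExplicites, (11) pp. 261–262 and the «lemme» p. 262] -/
theorem forall_weilPositivityOnChar_log_three_iff_of_prime_of_ne (hp : q.Prime) (h127 : q ≠ 127) :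
    (∀ χ : DirichletCharacter ℂ q, WeilPositivityOnChar χ (Real.log 3)) ↔ 131 ≤ q := by
  constructor
  · intro h
    by_contra hlt
    have h113 : q ≤ 113 := by
      by_contra h'
      have h114 : 114 ≤ q := by omega
      have h130 : q ≤ 130 := by omega
      interval_cases q
      all_goals first | exact h127 rfl | exact absurd hp (by norm_num)
    exact not_weilPositivityOnChar_log_three_principal_of_prime_le hp h113 (h 1)
  · intro h131 χ
    exact weilPositivityOnChar_log_three_of_ge_131 h131 χ

end UniformFloor

end Summit.Ventures.WeilGRH

end
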